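import Literature.MathematicalPhysics.QuantumFieldTheory.Balaban1983to89.B2Eq328ConcretePieces

/-!
# `Balaban1983to89.B2Eq324NestedRegions` — [Balaban1982Higgs2] §3.B p. 588, (3.22)–(3.24): the region data of (3.23)/(3.24)
BUILT from a tower of large-field regions `Λ₅⁽⁰⁾, Λ₅⁽¹⁾, …, Λ₅⁽ᴷ⁾ = ∅` (each `Λ₅⁽ᵏ⁾ ⊂ T⁽ᵏ⁾` a union of blocks, nested:
`B(Λ₅⁽ᵏ⁺¹⁾) ⊂ Λ₅⁽ᵏ⁾`) by `Λ_k := Λ₅⁽ᵏ⁻¹⁾′ ∩ Λ₅⁽ᵏ⁾ᶜ`, and the PROOF that these satisfy the nested-geometry hypothesis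
`B2Eq328ConcretePieces.Nested` (`Λ₅⁽⁰⁾ = ⨆_{k=1}^{K} Bᵏ(Λ_k)`) under which (3.28) was proved there — so `eq328_concrete` /
`prop31_concrete` apply to the printed regions

statement-level skeleton of published theorems with citation tags; proofs where landed; nothing here is a claim about the Yang–Mills mass gap

CITATION HEADER.  T. Bałaban, *(Higgs)₂,₃ quantum fields in a finite volume. II. An upper bound*, Commun. Math. Phys. **86**
(1982) 555–594 [Balaban1982Higgs2] (PDF held `paper:balaban1982-cmp86-higgs23-ii`; p. 588 [PDF 34] READ AS IMAGE on the ×2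
render `run/shared/lean/pub/pub-balaban/b2b-balaban-ref1/pages/1982-cmp86-higgs23-II/1982-cmp86-higgs23-II-p034-x2.png`;
p. 558 [PDF 4] for (2.7)–(2.8)).  Unit `lit-balaban-p15` gen 4, target 2, file 4 (Phase-2 proof seat p15).  SKELETON rows
**B2.Eq3.25** ((3.21)–(3.25), the region bookkeeping of (3.22)–(3.24)) and **B2.Eq3.29** ((3.28)); owner r02.

WHAT IS PRINTED (p. 588, verbatim): *"we compose the renormalization transformations localized in the sets
Λ₅⁽ᵏ⁻¹⁾′∩Λ₅⁽ᵏ⁾ᶜ ⊂ T⁽ᵏ⁾_{Lᵏε}, integrating over the fields φ₁, …, φ_{k−1} localized suitably in the sets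
Bᵏ⁻¹(Λ₅⁽ᵏ⁻¹⁾′∩Λ₅⁽ᵏ⁾ᶜ), …, B¹(Λ₅⁽ᵏ⁻¹⁾′∩Λ₅⁽ᵏ⁾ᶜ)"*; after (3.23): *"where Λ₅⁽ᴷ⁾ = ∅."*; (3.24): *"a configuration Φ defined on
the sum of sets Λ₅⁽⁰⁾ᶜ ∪ ⋃_{k=1}^{K} (Λ₅⁽ᵏ⁻¹⁾′∩Λ₅⁽ᵏ⁾ᶜ)"*; p. 558 (2.7)–(2.8): the large-field regions are *"the sum of all large
blocks"* (unions of blocks of the block hierarchy of part I, (I.1.16)–(I.1.20)).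

DICTIONARY.  `Tower P K`: `lam k` ↦ `Λ₅⁽ᵏ⁾ ⊂ T⁽ᵏ⁾` (k = 0, …, K), `top` ↦ *"Λ₅⁽ᴷ⁾ = ∅"*, `isUnion` ↦ `Λ₅⁽ᵏ⁾` is a union of
blocks `B(y)`, `y ∈ T⁽ᵏ⁺¹⁾` (so that `Λ₅⁽ᵏ⁾′ = Λ₅⁽ᵏ⁾ ∩ T⁽ᵏ⁺¹⁾` = the coarse sites whose block lies in `Λ₅⁽ᵏ⁾`, `prime`), `nested` ↦
`B(Λ₅⁽ᵏ⁺¹⁾) ⊂ Λ₅⁽ᵏ⁾` (the step-(k+1) large-field region lies inside the step-k one); `Tower.regions` ↦ the data `Regions P K` of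
`B2Eq337ScalarIntegration` with `inner = Λ₅⁽⁰⁾` and `block j = Λ_{j+1} = Λ₅⁽ʲ⁾′ ∖ Λ₅⁽ʲ⁺¹⁾`.

WHAT THIS MODULE PROVES (kernel-checked, 0 `sorry`, standard axioms): `inPiece_regions_iff` (`x ∈ Bʲ⁺¹(Λ_{j+1})` iff
`x_j ∈ Λ₅⁽ʲ⁾` and `x_{j+1} ∉ Λ₅⁽ʲ⁺¹⁾`, `x_k` the k-block point of `x`), the monotonicity `lamAt_anti`, and **`Tower.nested_regions :
Nested T.regions`** — hence (3.28) `eq328_tower` and the reduction `prop31_tower` for the printed regions, BY NAME from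
`B2Eq328ConcretePieces`.
HONEST SCOPE.  The construction (2.7)–(2.8)/(3.11)–(3.20) of the regions from the field configurations is NOT formalized; the
three structural properties it delivers are the hypotheses `top`/`isUnion`/`nested`.
-/

noncomputable section

open MeasureTheory Finset Real
open scoped BigOperators ENNReal InnerProductSpace

namespace Literature.MathematicalPhysics.QuantumFieldTheory.Balaban1983to89.B2Eq324NestedRegions

open Literature.MathematicalPhysics.QuantumFieldTheory.Balaban1983to89.HiggsLattice
open Literature.MathematicalPhysics.QuantumFieldTheory.Balaban1983to89.HiggsAveraging
open Literature.MathematicalPhysics.QuantumFieldTheory.Balaban1983to89.HiggsCovariance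
open Literature.MathematicalPhysics.QuantumFieldTheory.Balaban1983to89.B2Eq337ScalarIntegration
open Literature.MathematicalPhysics.QuantumFieldTheory.Balaban1983to89.B2Eq325ConcreteSchur
open Literature.MathematicalPhysics.QuantumFieldTheory.Balaban1983to89.B2Ineq327ConcreteNeumann
open Literature.MathematicalPhysics.QuantumFieldTheory.Balaban1983to89.B2Eq328ConcretePieces

variable {P : HiggsLattice.Params} {N K : ℕ}

/-! ## §1 The tower of large-field regions and the regions `Λ_k = Λ₅⁽ᵏ⁻¹⁾′ ∩ Λ₅⁽ᵏ⁾ᶜ` -/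

/-- `x_{k+1} = (x_k)_1`: the iterated block point is the block point of the previous one (p. 608 of part I: *"x_j ∈ B(x_{j+1})"*;
definitional for the tree's `HiggsAveraging.blockIter`). [cite: Balaban1982Higgs1, (2.2) p.608] -/
theorem blockIter_succ_eq (k : ℕ) (x : HiggsLattice.Site P 0) :
    blockIter (k + 1) x = HiggsLattice.blockOf (blockIter k x) := rfl

/-- `Λ′ = Λ ∩ T⁽ᵏ⁺¹⁾` for a union of blocks `Λ ⊂ T⁽ᵏ⁾` ((I.1.16)/(I.1.19): the coarse lattice inside the fine one): the coarse
sites `y` whose block `B(y)` lies in `Λ`. [cite: Balaban1982Higgs2, (3.22) p.588] -/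
def prime {k : ℕ} (Λ : Finset (HiggsLattice.Site P k)) : Finset (HiggsLattice.Site P (k + 1)) :=
  univ.filter fun y => ∀ x : HiggsLattice.Site P k, HiggsLattice.blockOf x = y → x ∈ Λ

/-- Membership in `prime`. [cite: Balaban1982Higgs2, (3.22) p.588] -/
theorem mem_prime {k : ℕ} (Λ : Finset (HiggsLattice.Site P k)) (y : HiggsLattice.Site P (k + 1)) :
    y ∈ prime Λ ↔ ∀ x : HiggsLattice.Site P k, HiggsLattice.blockOf x = y → x ∈ Λ := by
  simp [prime]

/-- **The tower of large-field regions of §3** as data with its three structural properties: `Λ₅⁽ᵏ⁾ ⊂ T⁽ᵏ⁾` for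
`k = 0, …, K`, *"Λ₅⁽ᴷ⁾ = ∅"* (p. 588), each a union of blocks ((2.7)–(2.8): *"the sum of all large blocks"*), and nested
(`B(Λ₅⁽ᵏ⁺¹⁾) ⊂ Λ₅⁽ᵏ⁾`: the next large-field region is carved out of the previous one, (3.22)). [cite: Balaban1982Higgs2, (3.22)–(3.24) p.588] -/
structure Tower (P : HiggsLattice.Params) (K : ℕ) where
  /-- `Λ₅⁽ᵏ⁾ ⊂ T⁽ᵏ⁾` (meaningful for `k ≤ K`) -/
  lam : (k : ℕ) → Finset (HiggsLattice.Site P k)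
  /-- *"where Λ₅⁽ᴷ⁾ = ∅"* -/
  top : lam K = ∅
  /-- `Λ₅⁽ᵏ⁾` is a union of blocks `B(y)`, `y ∈ T⁽ᵏ⁺¹⁾` -/
  isUnion : ∀ k, k < K → ∀ x x' : HiggsLattice.Site P k, HiggsLattice.blockOf x = HiggsLattice.blockOf x' → (x ∈ lam k ↔ x' ∈ lam k)
  /-- `B(Λ₅⁽ᵏ⁺¹⁾) ⊂ Λ₅⁽ᵏ⁾` -/
  nested : ∀ k, k < K → ∀ x : HiggsLattice.Site P k, HiggsLattice.blockOf x ∈ lam (k + 1) → x ∈ lam k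

namespace Tower

variable (T : Tower P K)

/-- **The region data of (3.23)/(3.24) from the tower**: `Λ₅⁽⁰⁾` and `Λ_{j+1} = Λ₅⁽ʲ⁾′ ∩ Λ₅⁽ʲ⁺¹⁾ᶜ`.
[cite: Balaban1982Higgs2, (3.23)–(3.24) p.588] -/
def regions : Regions P K where
  inner := T.lam 0
  block j := prime (T.lam j.val) \ T.lam (j.val + 1)

/-- `x_k ∈ Λ₅⁽ᵏ⁾`: the `k`-block point of the site `x ∈ T_ε` lies in the step-`k` region. [cite: Balaban1982Higgs2, (3.22) p.588] -/
def lamAt (k : ℕ) (x : HiggsLattice.Site P 0) : Prop := blockIter k x ∈ T.lam k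

/-- At `k = 0`: `x ∈ Λ₅⁽⁰⁾`. [cite: Balaban1982Higgs2, (3.23) p.588] -/
theorem lamAt_zero (x : HiggsLattice.Site P 0) : T.lamAt 0 x ↔ x ∈ T.lam 0 := Iff.rfl

/-- At `k = K`: never (`Λ₅⁽ᴷ⁾ = ∅`). [cite: Balaban1982Higgs2, (3.23) p.588] -/
theorem not_lamAt_top (x : HiggsLattice.Site P 0) : ¬ T.lamAt K x := by
  unfold lamAt
  rw [T.top]
  exact Finset.notMem_empty _

/-- One step of monotonicity: `x_{k+1} ∈ Λ₅⁽ᵏ⁺¹⁾ ⇒ x_k ∈ Λ₅⁽ᵏ⁾` (nesting). [cite: Balaban1982Higgs2, (3.22) p.588] -/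
theorem lamAt_succ_imp {k : ℕ} (hk : k < K) (x : HiggsLattice.Site P 0) : T.lamAt (k + 1) x → T.lamAt k x := by
  unfold lamAt
  rw [blockIter_succ_eq]
  exact T.nested k hk _

/-- Monotonicity along the tower: `x_j ∈ Λ₅⁽ʲ⁾ ⇒ x_i ∈ Λ₅⁽ⁱ⁾` for `i ≤ j ≤ K`. [cite: Balaban1982Higgs2, (3.22) p.588] -/
theorem lamAt_anti {i j : ℕ} (hij : i ≤ j) (hj : j ≤ K) (x : HiggsLattice.Site P 0) : T.lamAt j x → T.lamAt i x := by
  induction j, hij using Nat.le_induction with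
  | base => exact id
  | succ j hij ih => exact fun h => ih (by omega) (T.lamAt_succ_imp (by omega) x h)

/-- **Membership in the pieces**: `x ∈ Bʲ⁺¹(Λ_{j+1})` iff `x_j ∈ Λ₅⁽ʲ⁾` and `x_{j+1} ∉ Λ₅⁽ʲ⁺¹⁾`.
[cite: Balaban1982Higgs2, (3.22)–(3.24) p.588] -/
theorem inPiece_regions_iff (j : Fin K) (x : HiggsLattice.Site P 0) :
    inPiece T.regions j x ↔ T.lamAt j.val x ∧ ¬ T.lamAt (j.val + 1) x := by
  show blockIter (j.val + 1) x ∈ prime (T.lam j.val) \ T.lam (j.val + 1) ↔ _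
  rw [Finset.mem_sdiff, mem_prime]
  refine and_congr ⟨fun h => h _ (blockIter_succ_eq j.val x).symm, fun h x' hx' => ?_⟩ Iff.rfl
  rw [blockIter_succ_eq] at hx'
  exact (T.isUnion j.val j.isLt x' (blockIter j.val x) hx').mpr h

/-- From `p 0` and `¬ p K` there is a first descent `p j ∧ ¬ p (j+1)`, `j < K`. [folklore] [cite: Balaban1982Higgs2, (3.24) p.588] -/
theorem exists_descent {p : ℕ → Prop} : ∀ (K : ℕ), p 0 → ¬ p K → ∃ j, j < K ∧ p j ∧ ¬ p (j + 1)
  | 0, h0, hK => absurd h0 hK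
  | K + 1, h0, hK => by
      by_cases h : p K
      · exact ⟨K, Nat.lt_succ_self K, h, hK⟩
      · obtain ⟨j, hj, hpj, hpj'⟩ := exists_descent K h0 h
        exact ⟨j, Nat.lt_succ_of_lt hj, hpj, hpj'⟩

/-- **The printed regions satisfy the nested-geometry hypothesis**: `Λ₅⁽⁰⁾ = ⨆_{k=1}^{K} Bᵏ(Λ_k)` (every site of `Λ₅⁽⁰⁾` lies in
exactly one `Bᵏ(Λ_k)`, and these lie in `Λ₅⁽⁰⁾`). [cite: Balaban1982Higgs2, (3.22)–(3.24) p.588] -/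
theorem nested_regions : Nested T.regions where
  cover x := by
    constructor
    · intro hx
      have h0 : T.lamAt 0 x := hx
      obtain ⟨j, hj, hpj, hpj'⟩ := exists_descent (p := fun k => T.lamAt k x) K h0 (T.not_lamAt_top x)
      exact ⟨⟨j, hj⟩, (T.inPiece_regions_iff ⟨j, hj⟩ x).mpr ⟨hpj, hpj'⟩⟩
    · rintro ⟨j, hj⟩
      have h := ((T.inPiece_regions_iff j x).mp hj).1
      exact (T.lamAt_anti (Nat.zero_le _) (le_of_lt j.isLt) x h :)
  uniq x j j' hj hj' := by
    have h1 := (T.inPiece_regions_iff j x).mp hj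
    have h2 := (T.inPiece_regions_iff j' x).mp hj'
    by_contra hne
    rcases lt_or_gt_of_ne (fun h : j.val = j'.val => hne (Fin.ext h)) with hlt | hlt
    · exact h1.2 (T.lamAt_anti (Nat.succ_le_of_lt hlt) (le_of_lt j'.isLt) x h2.1)
    · exact h2.2 (T.lamAt_anti (Nat.succ_le_of_lt hlt) (le_of_lt j.isLt) x h1.1)

end Tower

/-! ## §2 (3.28) and the reduction of Proposition 3.1 for the printed regions -/

section Printed

variable (T : Tower P K) (C : ChargeData N) {a : ℝ} (A : HiggsLattice.VecField P 0) {msq : ℝ}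

/-- **(3.28) for the regions of the tower** (`B2Eq328ConcretePieces.eq328_concrete` with its hypothesis discharged).
[cite: Balaban1982Higgs2, (3.28) p.589] -/
theorem eq328_tower (ha : 0 < a) (hL : 1 < P.L) (hmsq : 0 ≤ msq) (Φ : Cfg T.regions N) :
    form325N T.regions C a T.nested_regions.pieces A msq Φ
      = outTerm T.regions C A msq Φ.1 + ∑ j, termForm T.regions C a A msq j (resL T.regions j Φ) :=
  eq328_concrete T.regions C A T.nested_regions ha hL hmsq Φ

/-- **Proposition 3.1 (3.26) reduced to (3.29) for the regions of the tower** (`B2Eq328ConcretePieces.prop31_concrete` with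
its geometric hypothesis discharged; (3.29) per scale stays a hypothesis). [cite: Balaban1982Higgs2, Prop. 3.1 (3.26) p.589] -/
theorem prop31_tower (ha : 0 < a) (hL : 1 < P.L) (hmsq : 0 < msq) {γ₀ : ℝ} (hγ₁ : γ₀ ≤ 1)
    (bond mass : (j : Fin K) → (LSite T.regions j → V N) → ℝ) (err : Fin K → ℝ)
    (h329 : ∀ (j : Fin K) (ψ : LSite T.regions j → V N),
      γ₀ * (bond j ψ + mass j ψ) - err j ≤ termForm T.regions C a A msq j ψ)
    (Φ : Cfg T.regions N) :
    γ₀ * (bond0 T.regions C A Φ.1 + ∑ j, bond j (resL T.regions j Φ))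
        + γ₀ * (mass0 T.regions msq Φ.1 + ∑ j, mass j (resL T.regions j Φ)) - ∑ j, err j
      ≤ form325 T.regions C a A msq Φ :=
  prop31_concrete T.regions C A T.nested_regions ha hL hmsq hγ₁ bond mass err h329 Φ

end Printed

end Literature.MathematicalPhysics.QuantumFieldTheory.Balaban1983to89.B2Eq324NestedRegions
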